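import Literature.AlgebraicGeometry.Frobenioids.Cor412AsPrinted
import Literature.AlgebraicGeometry.Frobenioids.Thm49Padic
import Literature.AlgebraicGeometry.Frobenioids.PadicFrobenioidCZeroSlim
import Literature.AlgebraicGeometry.Frobenioids.PadicFrobenioidRationallyStandard
import HarnessLib

/-!
# Frobenioids I, Corollary 4.12 at the `p`-adic Frobenioids of [FrdII] Example 1.1 — in the generality of
# [FrdII] Theorem 1.2 (i), and hypothesis-free at THE printed `C₀` over `D₀ = B(G_{ℚ_p})⁰`

Mochizuki, *The geometry of Frobenioids I: the general theory*, Kyushu J. Math. **62** (2008) 293–400, kurims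
text, Corollary 4.12 (Category-theoreticity of the Functor to an Elementary Frobenioid II), statement p. 94
l. 44 – p. 95 l. 17 [cite: MochizukiFrdI2008, Cor. 4.12 p.95]: for `D_i` Frobenius-slim, `C_i → F_{Φ_i}`
Frobenioids of rationally standard type and an equivalence `Ψ : C₁ ⥲ C₂` satisfying (b) of Thm. 3.4 (iv), there is
a `1`-unique functor `Ψ⁰ : F_{0_{D₁}} → F_{0_{D₂}}` `1`-commuting with `Ψ` over the natural projections
`C_i → F_{0_{D_i}}`; over slim bases the composites are rigid. Applied at Mochizuki, *The geometry of Frobenioids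
II: poly-Frobenioids*, Kyushu J. Math. **62** (2008) 401–460, Example 1.1 (i)/(ii) pp. 7–8 and Theorem 1.2 (i) p. 9
("If `D` is of FSMFF-type, then `C` is of rationally standard type"; `C₀` "of rationally standard type … over a slim
base category `D₀`") [cite: MochizukiFrdII2008, Ex 1.1 (i) p.7] [cite: MochizukiFrdII2008, Thm 1.2 (i) p.9].

PROOF-ONLY file (abc-iut cell, block F fact-proving wave, seat abc-iut-f-027 gen 2; node FrdI:Cor4.12, genuine-data
instance at the LOCAL Frobenioids — the tree had it only at the arithmetic Frobenioids `C_{K/F}`, abc-iut-w5-d222's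
`Cor412Arithmetic.lean`), 0 definitions. Since `Cor412AsPrinted.lean` (f-027 gen 0) the typed Cor. 4.12 holds at THE
Def. 4.5 (iii) parameters for EVERY pair of Frobenioids and every `Ψ`, no base hypothesis and no residual input
(`FrdI.cor412_rsParams`). Hence, for `p`-adic Frobenioid data `d_i : PadicFrd.Datum D_i p_i` (primes arbitrary):

* `PadicFrd.cor412_padic_of_isMonoidData` — the typed `PreFrobenioidData.Cor412` at THE parameters for every `Ψ`,
  given only print's standing convention that `Φ_i`, `B_i` are monoids on `D_i` ([FrdII] Ex. 1.1 (ii) "the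
  convention of [Mzk5], Definition 1.1, (ii)"; `Datum.IsMonoidData`, so that `C_i` IS a Frobenioid, [FrdI] Thm. 5.2
  (ii));
* `PadicFrd.cor412_conclusion_padic_of_isOfFSMFFType` — its CONCLUSION outright (the `1`-unique `Ψ⁰` and the
  slim-base rigidity clause) over FROBENIUS-SLIM bases of FSMFF-type: the antecedent "rationally standard type" is
  [FrdII] Thm. 1.2 (i) at THE parameters (`Datum.isOfRationallyStandardType_rsParams`) and hypothesis (b) is idle (a
  `p`-adic Frobenioid is not of group-like type); `…_of_isSlim` — over SLIM bases of FSMFF-type ("every slim category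
  is Frobenius-slim", [FrdI] Def. 3.1 (i); `IsSlim.isFrobeniusSlim`) both composites are rigid;
* `PadicFrd.cor412_czeroGal`, `cor412_conclusion_czeroGal` (`_refl`) — at THE `C₀(p)` of Ex. 1.1 (i) NOTHING is
  assumed: `D₀ = B(G_{ℚ_p})⁰` is slim (`PadicFrd.dZero_isSlim`, [AbsAnab] slimness of `G_{ℚ_p}`) and of FSMFF-type
  (`dZero_isOfFSMFFType`), its datum has monoid data (`zeroGal_isMonoidData`). Non-vacuity row NV-L1 «[FrdI]
  Cor. 4.12 closers INHABITED at genuine data», local case.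

No statement of either paper is restated or strengthened; no new definition; nothing here bears on, or takes a
side on, [IUTchIII] Cor. 3.12 (typed ≠ proved elsewhere; here proved = kernel-checked).
-/

noncomputable section

namespace Literature.AlgebraicGeometry.Frobenioids

open CategoryTheory Opposite
open PreFrobenioid PreFrobenioidData

namespace PadicFrd

universe v u

section TwoData

variable {D₁ : Type u} [Category.{v} D₁] {D₂ : Type u} [Category.{v} D₂]
variable {p₁ p₂ : ℕ} [Fact p₁.Prime] [Fact p₂.Prime]
variable (d₁ : Datum D₁ p₁) (d₂ : Datum D₂ p₂)

/-- **[FrdI] Cor. 4.12 AS TYPED for a pair of `p`-adic Frobenioids with `Φ_i`, `B_i` monoids on `D_i` and any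
equivalence `Ψ` between them, at THE Def. 4.5 (iii) parameters** (support = the primary support of Def. 2.4
(i)(d)) — the typed statement with its printed antecedents, NO hypothesis on the base categories (f-027's
`FrdI.cor412_rsParams`). [cite: MochizukiFrdI2008, Cor. 4.12 p.95] -/
theorem cor412_padic_of_isMonoidData (h₁ : d₁.IsMonoidData) (h₂ : d₂.IsMonoidData)
    (Ψ : d₁.frobenioid ≌ d₂.frobenioid) :
    (ModelFrobenioid.data d₁.Φ d₁.B d₁.divB).Cor412 (ModelFrobenioid.data d₂.Φ d₂.B d₂.divB) Ψ
      (rsParams (d₁.isFrobenioid_of_isMonoidData h₁) fun a 𝔭 => PrimarySupp a 𝔭)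
      (rsParams (d₂.isFrobenioid_of_isMonoidData h₂) fun a 𝔭 => PrimarySupp a 𝔭) :=
  FrdI.cor412_rsParams (d₁.isFrobenioid_of_isMonoidData h₁) (d₂.isFrobenioid_of_isMonoidData h₂) Ψ _ _

/-- **[FrdI] Cor. 4.12 at the `p`-adic Frobenioids — the CONCLUSION, in the generality of [FrdII] Thm. 1.2 (i).**
For `p`-adic Frobenioid data over FROBENIUS-SLIM bases `D_i` of FSMFF-type with `Φ_i`, `B_i` monoids on `D_i`, and
EVERY equivalence of categories `Ψ : C₁ ⥲ C₂`, there is a functor `Ψ⁰ : D₁ × ℕ_{≥1} ⥤ D₂ × ℕ_{≥1}` `1`-commuting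
with `Ψ` over the natural projections `C_i → F_{0_{D_i}} = D_i × ℕ_{≥1}` and `1`-unique with this property; if
moreover `D₁`, `D₂` are slim, the composites `C₁ → D₂ × ℕ_{≥1}` are rigid. The remaining printed antecedents are
discharged: rationally standard type at THE parameters ([FrdII] Thm. 1.2 (i), `Datum.isOfRationallyStandardType_rsParams`)
and hypothesis (b), idle since `C₁` is not of group-like type (`padic_not_isOfGroupLikeType`).
[cite: MochizukiFrdI2008, Cor. 4.12 p.95] [cite: MochizukiFrdII2008, Thm 1.2 (i) p.9] -/
theorem cor412_conclusion_padic_of_isOfFSMFFType (h₁ : d₁.IsMonoidData) (h₂ : d₂.IsMonoidData)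
    (hD₁ : IsOfFSMFFType D₁) (hD₂ : IsOfFSMFFType D₂) (hfs₁ : IsFrobeniusSlim D₁) (hfs₂ : IsFrobeniusSlim D₂)
    (Ψ : d₁.frobenioid ≌ d₂.frobenioid) :
    ∃ Ψ0 : D₁ × SingleObj ℕ+ ⥤ D₂ × SingleObj ℕ+,
      OneUniqueSquare Ψ.functor (ModelFrobenioid.data d₁.Φ d₁.B d₁.divB).toBaseDeg
          (ModelFrobenioid.data d₂.Φ d₂.B d₂.divB).toBaseDeg Ψ0 ∧
        (IsSlim D₁ → IsSlim D₂ →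
          IsRigidFunctor (Ψ.functor ⋙ (ModelFrobenioid.data d₂.Φ d₂.B d₂.divB).toBaseDeg) ∧
            IsRigidFunctor ((ModelFrobenioid.data d₁.Φ d₁.B d₁.divB).toBaseDeg ⋙ Ψ0)) :=
  cor412_padic_of_isMonoidData d₁ d₂ h₁ h₂ Ψ hfs₁ hfs₂ (d₁.isOfRationallyStandardType_rsParams h₁ hD₁)
    (d₂.isOfRationallyStandardType_rsParams h₂ hD₂) (fun hg₁ _ => absurd hg₁ (padic_not_isOfGroupLikeType d₁))

/-- **[FrdI] Cor. 4.12 at the `p`-adic Frobenioids over SLIM bases of FSMFF-type** (with `Φ_i`, `B_i` monoids on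
`D_i`): "every slim category is Frobenius-slim" ([FrdI] Def. 3.1 (i), `IsSlim.isFrobeniusSlim`), so for every
`Ψ : C₁ ⥲ C₂` the `1`-unique `Ψ⁰` exists AND both composites `C₁ → D₂ × ℕ_{≥1}` are rigid.
[cite: MochizukiFrdI2008, Cor. 4.12 p.95] [cite: MochizukiFrdII2008, Thm 1.2 (i) p.9] -/
theorem cor412_conclusion_padic_of_isSlim (h₁ : d₁.IsMonoidData) (h₂ : d₂.IsMonoidData)
    (hD₁ : IsOfFSMFFType D₁) (hD₂ : IsOfFSMFFType D₂) (hsl₁ : IsSlim D₁) (hsl₂ : IsSlim D₂)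
    (Ψ : d₁.frobenioid ≌ d₂.frobenioid) :
    ∃ Ψ0 : D₁ × SingleObj ℕ+ ⥤ D₂ × SingleObj ℕ+,
      OneUniqueSquare Ψ.functor (ModelFrobenioid.data d₁.Φ d₁.B d₁.divB).toBaseDeg
          (ModelFrobenioid.data d₂.Φ d₂.B d₂.divB).toBaseDeg Ψ0 ∧
        IsRigidFunctor (Ψ.functor ⋙ (ModelFrobenioid.data d₂.Φ d₂.B d₂.divB).toBaseDeg) ∧
          IsRigidFunctor ((ModelFrobenioid.data d₁.Φ d₁.B d₁.divB).toBaseDeg ⋙ Ψ0) := by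
  obtain ⟨Ψ0, hsq, hrig⟩ := cor412_conclusion_padic_of_isOfFSMFFType d₁ d₂ h₁ h₂ hD₁ hD₂ hsl₁.isFrobeniusSlim
    hsl₂.isFrobeniusSlim Ψ
  exact ⟨Ψ0, hsq, hrig hsl₁ hsl₂⟩

/-- Over bases of FSM-type (e.g. `B^temp(Π, Π°)⁰` of [FrdII] Ex. 1.3 (i)) the monoid-data and FSMFF hypotheses are
automatic (`isMonoidData_of_isOfFSMType`, `IsOfFSMType.isOfFSMFFType`): **[FrdI] Cor. 4.12 at `p`-adic Frobenioids
over slim bases of FSM-type, no further hypothesis.** [cite: MochizukiFrdI2008, Cor. 4.12 p.95] -/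
theorem cor412_conclusion_padic_of_isOfFSMType (hD₁ : IsOfFSMType D₁) (hD₂ : IsOfFSMType D₂)
    (hsl₁ : IsSlim D₁) (hsl₂ : IsSlim D₂) (Ψ : d₁.frobenioid ≌ d₂.frobenioid) :
    ∃ Ψ0 : D₁ × SingleObj ℕ+ ⥤ D₂ × SingleObj ℕ+,
      OneUniqueSquare Ψ.functor (ModelFrobenioid.data d₁.Φ d₁.B d₁.divB).toBaseDeg
          (ModelFrobenioid.data d₂.Φ d₂.B d₂.divB).toBaseDeg Ψ0 ∧
        IsRigidFunctor (Ψ.functor ⋙ (ModelFrobenioid.data d₂.Φ d₂.B d₂.divB).toBaseDeg) ∧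
          IsRigidFunctor ((ModelFrobenioid.data d₁.Φ d₁.B d₁.divB).toBaseDeg ⋙ Ψ0) :=
  cor412_conclusion_padic_of_isSlim d₁ d₂ (d₁.isMonoidData_of_isOfFSMType hD₁) (d₂.isMonoidData_of_isOfFSMType hD₂)
    hD₁.isOfFSMFFType hD₂.isOfFSMFFType hsl₁ hsl₂ Ψ

end TwoData

/-! ### At THE printed `C₀` over `D₀ = B(G_{ℚ_p})⁰`: nothing assumed -/

section CZero

variable (p₁ p₂ : ℕ) [Fact p₁.Prime] [Fact p₂.Prime]

/-- **[FrdI] Cor. 4.12 AS TYPED at THE `p`-adic Frobenioids `C₀(p₁)`, `C₀(p₂)` of [FrdII] Ex. 1.1 (i) and THE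
parameters**, for every equivalence `Ψ : C₀(p₁) ⥲ C₀(p₂)` — no hypothesis (`zeroGal_isMonoidData`).
[cite: MochizukiFrdI2008, Cor. 4.12 p.95] [cite: MochizukiFrdII2008, Ex 1.1 (i) p.7] -/
theorem cor412_czeroGal (Ψ : CZeroGal p₁ ≌ CZeroGal p₂) :
    (ModelFrobenioid.data (Datum.zeroGal p₁).Φ (Datum.zeroGal p₁).B (Datum.zeroGal p₁).divB).Cor412
      (ModelFrobenioid.data (Datum.zeroGal p₂).Φ (Datum.zeroGal p₂).B (Datum.zeroGal p₂).divB) Ψ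
      (rsParams ((Datum.zeroGal p₁).isFrobenioid_of_isMonoidData (zeroGal_isMonoidData p₁))
        fun a 𝔭 => PrimarySupp a 𝔭)
      (rsParams ((Datum.zeroGal p₂).isFrobenioid_of_isMonoidData (zeroGal_isMonoidData p₂))
        fun a 𝔭 => PrimarySupp a 𝔭) :=
  cor412_padic_of_isMonoidData _ _ (zeroGal_isMonoidData p₁) (zeroGal_isMonoidData p₂) Ψ

/-- **[FrdI] Cor. 4.12 at THE `C₀`'s — the CONCLUSION, with NO hypothesis**: for every equivalence of categories
`Ψ : C₀(p₁) ⥲ C₀(p₂)` there is a `1`-unique functor `Ψ⁰ : D₀(p₁) × ℕ_{≥1} ⥤ D₀(p₂) × ℕ_{≥1}` `1`-commuting with `Ψ`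
over the natural projections `C₀(p_i) → F_{0_{D₀(p_i)}}`, and both composites `C₀(p₁) → D₀(p₂) × ℕ_{≥1}` are rigid
— every printed antecedent of Cor. 4.12 being a theorem at this data: `D₀ = B(G_{ℚ_p})⁰` slim
(`PadicFrd.dZero_isSlim`), hence Frobenius-slim ([FrdI] Def. 3.1 (i)); `C₀` of rationally standard type ([FrdII]
Ex. 1.1 (i) / Thm. 1.2 (i); `D₀` of FSMFF-type, `dZero_isOfFSMFFType`); (b) idle (`C₀` not of group-like type).
[cite: MochizukiFrdI2008, Cor. 4.12 p.95] [cite: MochizukiFrdII2008, Ex 1.1 (i) p.7] -/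
theorem cor412_conclusion_czeroGal (Ψ : CZeroGal p₁ ≌ CZeroGal p₂) :
    ∃ Ψ0 : DZero p₁ × SingleObj ℕ+ ⥤ DZero p₂ × SingleObj ℕ+,
      OneUniqueSquare Ψ.functor
          (ModelFrobenioid.data (Datum.zeroGal p₁).Φ (Datum.zeroGal p₁).B (Datum.zeroGal p₁).divB).toBaseDeg
          (ModelFrobenioid.data (Datum.zeroGal p₂).Φ (Datum.zeroGal p₂).B (Datum.zeroGal p₂).divB).toBaseDeg Ψ0 ∧
        IsRigidFunctor (Ψ.functor ⋙
            (ModelFrobenioid.data (Datum.zeroGal p₂).Φ (Datum.zeroGal p₂).B (Datum.zeroGal p₂).divB).toBaseDeg) ∧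
          IsRigidFunctor
            ((ModelFrobenioid.data (Datum.zeroGal p₁).Φ (Datum.zeroGal p₁).B (Datum.zeroGal p₁).divB).toBaseDeg ⋙
              Ψ0) :=
  cor412_conclusion_padic_of_isSlim _ _ (zeroGal_isMonoidData p₁) (zeroGal_isMonoidData p₂)
    (dZero_isOfFSMFFType p₁) (dZero_isOfFSMFFType p₂) (dZero_isSlim p₁) (dZero_isSlim p₂) Ψ

/-- In particular, for every prime `p` and every self-equivalence `Ψ` of `C₀(p)` (e.g. the identity), the
`1`-unique `Ψ⁰` of Cor. 4.12 exists — a genuine-data inhabitant of the conclusion of the typed Cor. 4.12 at the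
LOCAL Frobenioids (the `refl` instance of the NV register). [cite: MochizukiFrdI2008, Cor. 4.12 p.95]
[cite: MochizukiFrdII2008, Ex 1.1 (i) p.7] -/
theorem cor412_conclusion_czeroGal_refl :
    ∃ Ψ0 : DZero p₁ × SingleObj ℕ+ ⥤ DZero p₁ × SingleObj ℕ+,
      OneUniqueSquare (𝟭 (CZeroGal p₁))
          (ModelFrobenioid.data (Datum.zeroGal p₁).Φ (Datum.zeroGal p₁).B (Datum.zeroGal p₁).divB).toBaseDeg
          (ModelFrobenioid.data (Datum.zeroGal p₁).Φ (Datum.zeroGal p₁).B (Datum.zeroGal p₁).divB).toBaseDeg Ψ0 :=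
  let ⟨Ψ0, h, _⟩ := cor412_conclusion_czeroGal p₁ p₁ (CategoryTheory.Equivalence.refl (C := CZeroGal p₁))
  ⟨Ψ0, h⟩

end CZero

end PadicFrd

end Literature.AlgebraicGeometry.Frobenioids

end
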